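import Summits.CriticalPhenomena.PercolationContinuityZ3.Theorems.Transplant.KNLevelsTargetChain
import HarnessLib

/-!
# Corridor, generic — CHAINS of target steps with ENLARGED TARGETS (edge contacts): each step of the chain applies the target property to a
# target `T_i ⊇ T'_i` (the true target `T'_i` plus the faces behind the contacts that have no route — for `X □ ℤ²`: the contacts near the
# fibre edge of the window, p3-g2's `hIV_of_mem_face`), and the excess `P_W(o ↔ T_i \ T'_i) ≤ η` (a collar estimate) is subtracted before
# the next step, whose core contains `T'_i` only (extends stmt's `KNLevels.TargetProperty.chain`, p212753)

builds on p205010 (kernel theorem, internal audit signed; external expert review pending) — nothing in this file uses p205010.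
Lane `prim-bschramm`, seat `prim-bschramm-p2` (Corridor-over-levels, lead 10:50Z); helper file (`--supports stmt-CriticalPhenomena-4575`).

* `real_biUnion_openConn_le_add_sdiff` — `P(o ↔ T) ≤ P(o ↔ T') + P(o ↔ T \ T')` for `T' ⊆ T`;
* **`TargetProperty.chain_edge`** — for every `ε > 0` and `n` there is `δ ∈ (0, 1]` such that for every weighting, every chain of `n + 1` steps
  with common source, true targets `T'_i ⊆ T_i` linked by `T'_i ⊆ X_{i+1}(0)`, kits at accuracy `δ`, excess bounded by `η ≤ δ / 2`:
  `1 - δ < P_W(o ↔ X_0(0))` implies `1 - ε < P_W(o ↔ T'_n)`.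
[cite: KozmaNitzan2024, §4 Lemma 11 (p. 22), Lemma 12 (pp. 23–25)] [cite: GrimmettPercolation1999, §7.2]
-/

noncomputable section

open MeasureTheory ProbabilityTheory

namespace Summit.CriticalPhenomena.PercolationContinuityZ3.Theorems

namespace Transplant

namespace KNLevels

open Literature.Probability.Percolation Literature.Probability.LatticeModels SimpleGraph

variable {V : Type*} [DecidableEq V] {G : SimpleGraph V} [G.LocallyFinite]

omit [DecidableEq V] [G.LocallyFinite] in
/-- `P(o ↔ T) ≤ P(o ↔ T') + P(o ↔ T \ T')` for `T' ⊆ T`. [folklore] -/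
theorem real_biUnion_openConn_le_add_sdiff [DecidableEq V] (μ : Measure (BondConfig V)) [IsFiniteMeasure μ] (o : V) {T T' : Finset V}
    (h : T' ⊆ T) :
    μ.real (⋃ t ∈ T, openConn o t) ≤ μ.real (⋃ t ∈ T', openConn o t) + μ.real (⋃ t ∈ T \ T', openConn o t) := by
  refine le_trans (measureReal_mono ?_ (measure_ne_top _ _)) (measureReal_union_le _ _)
  intro ω hω
  simp only [Set.mem_iUnion, exists_prop] at hω
  obtain ⟨t, ht, hωt⟩ := hω
  by_cases ht' : t ∈ T'
  · exact Or.inl (Set.mem_biUnion (Finset.mem_coe.2 ht') hωt)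
  · have _ := h
    exact Or.inr (Set.mem_biUnion (Finset.mem_coe.2 (Finset.mem_sdiff.2 ⟨ht, ht'⟩)) hωt)

/-- **CHAINS with enlarged targets.**  For every `ε > 0` and `n` there is one accuracy `δ ∈ (0, 1]` such that, for every weighting `W`, every
chain `s₀, …, s_n` of steps with a common source, true targets `T'_i ⊆ T_i = (s i).T` linked by `T'_i ⊆ X_{i+1}(0)`, kits at accuracy `δ`, and
excess `P_W(o ↔ T_i \ T'_i) ≤ η` with `η ≤ δ / 2`: `1 - δ < P_W(o ↔ X_0(0))` implies `1 - ε < P_W(o ↔ T'_n)`.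
[cite: KozmaNitzan2024, §4 Lemma 11 (p. 22), Lemma 12 (pp. 23–25)] -/
theorem TargetProperty.chain_edge {Δ : ℕ} {p : unitInterval} (hT : TargetProperty G Δ p) (n : ℕ) {ε : ℝ} (hε : 0 < ε) :
    ∃ δ : ℝ, 0 < δ ∧ δ ≤ 1 ∧ ∀ (W : Sym2 V → unitInterval) (s : Fin (n + 1) → TStep G) (T' : Fin (n + 1) → Finset V) (η : ℝ),
      (∀ i : Fin (n + 1), (s i).L.o = (s 0).L.o) →
      (∀ i : Fin n, T' (Fin.castSucc i) ⊆ (s i.succ).L.X 0) →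
      (∀ i : Fin (n + 1), T' i ⊆ (s i).T) →
      (∀ i : Fin (n + 1), (s i).KitsAt W p Δ δ) →
      η ≤ δ / 2 →
      (∀ i : Fin (n + 1), (prodBernoulli W).real (⋃ t ∈ (s i).T \ T' i, openConn (s 0).L.o t) ≤ η) →
      1 - δ < (prodBernoulli W).real (s 0).L.reachB →
        1 - ε < (prodBernoulli W).real (⋃ t ∈ T' (Fin.last n), openConn (s 0).L.o t) := by
  induction n generalizing ε with
  | zero =>
    obtain ⟨δ₁, hδ₁, hδ₁1, h⟩ := hT.apply_step (half_pos hε)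
    refine ⟨min δ₁ ε, lt_min hδ₁ hε, (min_le_left _ _).trans hδ₁1, fun W s T' η _ _ hsub hk hη hexc hreach => ?_⟩
    have h1 := h W (s 0) ((hk 0).mono (min_le_left _ _)) (lt_of_le_of_lt (by linarith [min_le_left δ₁ ε]) hreach)
    have h2 := real_biUnion_openConn_le_add_sdiff (prodBernoulli W) (s 0).L.o (hsub 0)
    have h3 := hexc 0
    have h4 : η ≤ ε / 2 := hη.trans (by linarith [min_le_right δ₁ ε])
    show 1 - ε < (prodBernoulli W).real (⋃ t ∈ T' 0, openConn (s 0).L.o t)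
    linarith
  | succ n ih =>
    obtain ⟨δ₁, hδ₁, hδ₁1, hlast⟩ := hT.apply_step (half_pos hε)
    obtain ⟨δ₀, hδ₀, hδ₀1, hfirst⟩ := ih hδ₁
    refine ⟨min δ₀ (min δ₁ ε), lt_min hδ₀ (lt_min hδ₁ hε), (min_le_left _ _).trans hδ₀1,
      fun W s T' η ho hlink hsub hk hη hexc hreach => ?_⟩
    have hmin0 : min δ₀ (min δ₁ ε) ≤ δ₀ := min_le_left _ _
    have hmin1 : min δ₀ (min δ₁ ε) ≤ δ₁ := (min_le_right _ _).trans (min_le_left _ _)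
    have hminε : min δ₀ (min δ₁ ε) ≤ ε := (min_le_right _ _).trans (min_le_right _ _)
    -- the truncated chain
    set s' : Fin (n + 1) → TStep G := fun i => s (Fin.castSucc i) with hs'
    set T'' : Fin (n + 1) → Finset V := fun i => T' (Fin.castSucc i) with hT''
    have ho' : ∀ i : Fin (n + 1), (s' i).L.o = (s' 0).L.o := fun i => by
      simp only [hs']; rw [ho (Fin.castSucc i)]; exact (ho (Fin.castSucc 0)).symm
    have h0 : (s' 0).L.o = (s 0).L.o := rfl
    have hlink' : ∀ i : Fin n, T'' (Fin.castSucc i) ⊆ (s' i.succ).L.X 0 := fun i => by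
      simp only [hs', hT'']
      have := hlink (Fin.castSucc i)
      have e : (Fin.castSucc i).succ = Fin.castSucc i.succ := Fin.ext (by simp)
      rwa [e] at this
    have hsub' : ∀ i : Fin (n + 1), T'' i ⊆ (s' i).T := fun i => hsub (Fin.castSucc i)
    have hk' : ∀ i : Fin (n + 1), (s' i).KitsAt W p Δ δ₀ := fun i => (hk (Fin.castSucc i)).mono hmin0
    have hη' : η ≤ δ₀ / 2 := hη.trans (by linarith)
    have hexc' : ∀ i : Fin (n + 1), (prodBernoulli W).real (⋃ t ∈ (s' i).T \ T'' i, openConn (s' 0).L.o t) ≤ η := fun i => by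
      rw [h0]; exact hexc (Fin.castSucc i)
    have hreach' : 1 - δ₀ < (prodBernoulli W).real (s' 0).L.reachB := by
      have : (s' 0) = s 0 := rfl
      rw [this]; exact lt_of_le_of_lt (by linarith) hreach
    have hmid := hfirst W s' T'' η ho' hlink' hsub' hk' hη' hexc' hreach'
    -- `T'_n ⊆ X_{n+1}(0)`: the last step's core is reached
    have hlastlink : T'' (Fin.last n) ⊆ (s (Fin.last (n + 1))).L.X 0 := by
      have := hlink (Fin.last n)
      simp only [hT'']
      rwa [Fin.succ_last] at this
    have holast : (s (Fin.last (n + 1))).L.o = (s 0).L.o := ho _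
    have hsubB : (⋃ t ∈ T'' (Fin.last n), openConn (s 0).L.o t) ⊆ (s (Fin.last (n + 1))).L.reachB := by
      intro ω hω
      simp only [Set.mem_iUnion, exists_prop] at hω
      obtain ⟨t, ht, hωt⟩ := hω
      unfold LData.reachB
      rw [holast]
      exact Set.mem_biUnion (Finset.mem_coe.2 (hlastlink ht)) hωt
    have hreachLast : 1 - δ₁ < (prodBernoulli W).real (s (Fin.last (n + 1))).L.reachB := by
      rw [h0] at hmid
      exact lt_of_lt_of_le hmid (measureReal_mono hsubB (measure_ne_top _ _))
    have h1 := hlast W (s (Fin.last (n + 1))) ((hk _).mono hmin1) hreachLast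
    rw [holast] at h1
    have h2 := real_biUnion_openConn_le_add_sdiff (prodBernoulli W) (s 0).L.o (hsub (Fin.last (n + 1)))
    have h3 := hexc (Fin.last (n + 1))
    have h4 : η ≤ ε / 2 := hη.trans (by linarith)
    linarith

end KNLevels

end Transplant

end Summit.CriticalPhenomena.PercolationContinuityZ3.Theorems

end
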